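import Mathlib
import HarnessLib
import Summits.NavierStokesRegularity.NavierStokesRegularity.Theses.PoloidalWindowDoor
import Summits.NavierStokesRegularity.NavierStokesRegularity.Theorems.PoloidalWindowDoorPoloidalWindowRigiditySharper
import Summits.NavierStokesRegularity.NavierStokesRegularity.Theorems.PoloidalWindowDoorPoloidalWindowRigidityEntireGerm
import Summits.NavierStokesRegularity.NavierStokesRegularity.Theorems.PoloidalWindowDoorPoloidalWindowRigidityTimeShearClosed

/-!
# Route `PoloidalWindowDoor`: the crux `PoloidalWindowRigidity` (K2, stmt-NavierStokesRegularity-19708) FROM THE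
# PROMOTED ITEM `LrcModEntire` (stmt-NavierStokesRegularity-20428) — the split glue, both route declarations BY NAME

Cell ns-regularity-ideate, seat nsreg-p7 gen 9 (structural worker of record on `LrcModEntire`; DIRECTOR-NS g8 #31).
The K2 lead's skeleton `lrc-jet` v3 (ns-poloidal-K2-p1 g4, `Cruxes/PoloidalWindowRigidity/Lines/lrc_jet.lean`,
sha16 c0e7e03c13a358bb) composes the crux from ONE registered stub, `stub_lrcModEntire`; that stub was promoted
verbatim to the route item `LrcModEntire` (planner nsreg-p1 g15, 2026-08-27T11:29Z).  This file is the same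
composition stated as a TREE THEOREM whose hypothesis is the item's statement VERBATIM (the route declaration
`Summit.…Theses.PoloidalWindowDoor.LrcModEntire` unfolds to it by `rfl`; it is spelled out here only because the farm
snapshot of the route file predates the item) and whose conclusion is the crux declaration BY NAME, so that the crux closes by the one-liner
`poloidalWindowRigidity_of_lrcModEntire LrcModEntire_holds` the moment the item lands (D-0059: glue proved first):

* `lrcSpatial_of_lrcModEntire` — inside the route's Type-I class the item's third alternative («the slice agrees
  on an open set with an entire real-analytic field of unbounded norm») is absurd (nsreg-p7 g8's
  `…EntireGerm.not_slice_eqOn_open_of_not_bddAbove`), so `LrcModEntire` gives LRC″ with spatial pins in the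
  two-alternative form (= v2's `stub_lrcSpatial`, the hypothesis `hLRC` of ns-poloidal-K2-p3 g4's
  `…K2OfLrcSpatial.nonflatLiouville_of_lrc_spatial`);
* `lrcModEntire_of_lrcSpatial` — the converse embedding (so, for the ledger: the item and v2's stub are
  equivalent statements);
* `poloidalWindowRigidity_of_lrcSpatial` — K2 from the two-alternative form: ns-poloidal-K2-p2 g3's
  `…TimeShearClosed.lrcSpatial_closes_tv` ((TV) is a tree theorem) + the K2 lead's
  `…Sharper.poloidalWindowRigidity_of_sliceSharpNonflatLiouville`;
* `poloidalWindowRigidity_of_lrcModEntire` — **`LrcModEntire → PoloidalWindowRigidity`**.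

WHAT THIS IS NOT: not a claim about Navier–Stokes regularity and not a proof of K2 or of `LrcModEntire` — the
kernel-checked implication between two OPEN route items (bears_on LADDER-NS N0, rung N0-LocalTubeDoorPoloidal;
`--supports` the K2 item).
-/

noncomputable section

-- the summit and its single sub-problem share the name (CONVENTIONS §1), as in every Theorems file
set_option linter.dupNamespace false

namespace Summit.NavierStokesRegularity.NavierStokesRegularity.Theorems.PoloidalWindowDoorPoloidalWindowRigidityK2OfLrcModEntire

open Set Function
open scoped RealInnerProductSpace InnerProductSpace
open Literature.Analysis Literature.Analysis.FluidPDE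
open Summit.NavierStokesRegularity.NavierStokesRegularity.Theses.PoloidalWindowDoor (PoloidalWindowRigidity)
open Summit.NavierStokesRegularity.NavierStokesRegularity.Theorems.PoloidalWindowDoorPoloidalWindowRigiditySharper
open Summit.NavierStokesRegularity.NavierStokesRegularity.Theorems.PoloidalWindowDoorPoloidalWindowRigidityEntireGerm
open Summit.NavierStokesRegularity.NavierStokesRegularity.Theorems.PoloidalWindowDoorPoloidalWindowRigidityTimeShearClosed

/-- **`LrcModEntire` ⇒ LRC″ with spatial pins (two alternatives; v2's `stub_lrcSpatial`).**  For a profile of the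
route's Type-I class an entire field carrying a germ of a slice obeys the Type-I bound everywhere, so the item's third
alternative cannot occur (`…EntireGerm.not_slice_eqOn_open_of_not_bddAbove`, nsreg-p7 g8). -/
theorem lrcSpatial_of_lrcModEntire
    (h : (∀ (C : ℝ) (v : ℝ → EuclideanSpace ℝ (Fin 3) → EuclideanSpace ℝ (Fin 3)),
      HasTypeITimeDecay C v →
      ContinuousOn (Function.uncurry v) (Set.Iio (0 : ℝ) ×ˢ Set.univ) →
      (∀ s t : ℝ, s < t → t < 0 → ∀ x, v t x =
        UnboundedOperators.heatExtension (v s) (t - s) x - oseenDuhamel 1 s v v t x) →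
      (∀ t < 0, VectorCalculus.IsDivFree (v t)) →
      (∀ s < 0, ∀ y, ⟪curl (v s) y, EuclideanSpace.single 2 1⟫_ℝ = 0) →
      ∀ W : Set (ℝ × EuclideanSpace ℝ (Fin 3)), IsOpen W → W.Nonempty → W ⊆ Set.Iio (0 : ℝ) ×ˢ Set.univ →
        (∀ z ∈ W, curl (v z.1) z.2 ≠ 0 ∧
          (fderiv ℝ (v z.1) z.2 (EuclideanSpace.single 0 1) 2 ≠ 0 ∨ fderiv ℝ (v z.1) z.2 (EuclideanSpace.single 1 1) 2 ≠ 0) ∧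
          (fderiv ℝ (v z.1) z.2 (EuclideanSpace.single 2 1) 0 ≠ 0 ∨ fderiv ℝ (v z.1) z.2 (EuclideanSpace.single 2 1) 1 ≠ 0)) →
        (∀ m : ℝ → ℝ, ∀ W₁ : Set (ℝ × EuclideanSpace ℝ (Fin 3)), W₁ ⊆ W → IsOpen W₁ → W₁.Nonempty →
          ∃ z ∈ W₁, ∃ b : Fin 3, b ≠ 2 ∧
            fderiv ℝ (v z.1) z.2 (EuclideanSpace.single 2 1) b ≠ m z.1 * fderiv ℝ (v z.1) z.2 (EuclideanSpace.single b 1) 2) →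
        ∃ s : ℝ, s < 0 ∧ ∃ U : Set (EuclideanSpace ℝ (Fin 3)), IsOpen U ∧ U.Nonempty ∧
          ((∃ e : EuclideanSpace ℝ (Fin 3), e ≠ 0 ∧ ∀ y ∈ U, fderiv ℝ (curl (v s)) y e = 0) ∨
           (∃ c : EuclideanSpace ℝ (Fin 3), ∀ y ∈ U,
              rotGen (curl (v s) y) = fderiv ℝ (curl (v s)) y (rotGen (y - c))) ∨
           (∃ w : EuclideanSpace ℝ (Fin 3) → EuclideanSpace ℝ (Fin 3), AnalyticOnNhd ℝ w Set.univ ∧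
              ¬ BddAbove (Set.range fun y => ‖w y‖) ∧ ∀ y ∈ U, v s y = w y)))) :
    ∀ (C : ℝ) (v : ℝ → EuclideanSpace ℝ (Fin 3) → EuclideanSpace ℝ (Fin 3)),
      HasTypeITimeDecay C v →
      ContinuousOn (Function.uncurry v) (Set.Iio (0 : ℝ) ×ˢ Set.univ) →
      (∀ s t : ℝ, s < t → t < 0 → ∀ x, v t x =
        UnboundedOperators.heatExtension (v s) (t - s) x - oseenDuhamel 1 s v v t x) →
      (∀ t < 0, VectorCalculus.IsDivFree (v t)) →
      (∀ s < 0, ∀ y, ⟪curl (v s) y, EuclideanSpace.single 2 1⟫_ℝ = 0) →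
      ∀ W : Set (ℝ × EuclideanSpace ℝ (Fin 3)), IsOpen W → W.Nonempty → W ⊆ Set.Iio (0 : ℝ) ×ˢ Set.univ →
        (∀ z ∈ W, curl (v z.1) z.2 ≠ 0 ∧
          (fderiv ℝ (v z.1) z.2 (EuclideanSpace.single 0 1) 2 ≠ 0 ∨ fderiv ℝ (v z.1) z.2 (EuclideanSpace.single 1 1) 2 ≠ 0) ∧
          (fderiv ℝ (v z.1) z.2 (EuclideanSpace.single 2 1) 0 ≠ 0 ∨ fderiv ℝ (v z.1) z.2 (EuclideanSpace.single 2 1) 1 ≠ 0)) →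
        (∀ m : ℝ → ℝ, ∀ W₁ : Set (ℝ × EuclideanSpace ℝ (Fin 3)), W₁ ⊆ W → IsOpen W₁ → W₁.Nonempty →
          ∃ z ∈ W₁, ∃ b : Fin 3, b ≠ 2 ∧
            fderiv ℝ (v z.1) z.2 (EuclideanSpace.single 2 1) b ≠ m z.1 * fderiv ℝ (v z.1) z.2 (EuclideanSpace.single b 1) 2) →
        ∃ s : ℝ, s < 0 ∧ ∃ U : Set (EuclideanSpace ℝ (Fin 3)), IsOpen U ∧ U.Nonempty ∧
          ((∃ e : EuclideanSpace ℝ (Fin 3), e ≠ 0 ∧ ∀ y ∈ U, fderiv ℝ (curl (v s)) y e = 0) ∨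
           (∃ c : EuclideanSpace ℝ (Fin 3), ∀ y ∈ U,
              rotGen (curl (v s) y) = fderiv ℝ (curl (v s)) y (rotGen (y - c)))) := by
  intro C v hrate hcont hmild hdiv hpol W hW hWne hWs hnd hpin
  obtain ⟨s, hs, U, hU, hUne, halt⟩ := h C v hrate hcont hmild hdiv hpol W hW hWne hWs hnd hpin
  rcases halt with htr | hrot | ⟨w, hw, hunb, heq⟩
  · exact ⟨s, hs, U, hU, hUne, Or.inl htr⟩
  · exact ⟨s, hs, U, hU, hUne, Or.inr hrot⟩
  · exact absurd heq (not_slice_eqOn_open_of_not_bddAbove hrate hcont hmild hs hw hunb hU hUne)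

/-- **The converse embedding**: the two-alternative form implies `LrcModEntire` (drop the third alternative).  With
`lrcSpatial_of_lrcModEntire`: the item and v2's registered stub `stub_lrcSpatial` are EQUIVALENT statements. -/
theorem lrcModEntire_of_lrcSpatial
    (h : ∀ (C : ℝ) (v : ℝ → EuclideanSpace ℝ (Fin 3) → EuclideanSpace ℝ (Fin 3)),
      HasTypeITimeDecay C v →
      ContinuousOn (Function.uncurry v) (Set.Iio (0 : ℝ) ×ˢ Set.univ) →
      (∀ s t : ℝ, s < t → t < 0 → ∀ x, v t x =
        UnboundedOperators.heatExtension (v s) (t - s) x - oseenDuhamel 1 s v v t x) →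
      (∀ t < 0, VectorCalculus.IsDivFree (v t)) →
      (∀ s < 0, ∀ y, ⟪curl (v s) y, EuclideanSpace.single 2 1⟫_ℝ = 0) →
      ∀ W : Set (ℝ × EuclideanSpace ℝ (Fin 3)), IsOpen W → W.Nonempty → W ⊆ Set.Iio (0 : ℝ) ×ˢ Set.univ →
        (∀ z ∈ W, curl (v z.1) z.2 ≠ 0 ∧
          (fderiv ℝ (v z.1) z.2 (EuclideanSpace.single 0 1) 2 ≠ 0 ∨ fderiv ℝ (v z.1) z.2 (EuclideanSpace.single 1 1) 2 ≠ 0) ∧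
          (fderiv ℝ (v z.1) z.2 (EuclideanSpace.single 2 1) 0 ≠ 0 ∨ fderiv ℝ (v z.1) z.2 (EuclideanSpace.single 2 1) 1 ≠ 0)) →
        (∀ m : ℝ → ℝ, ∀ W₁ : Set (ℝ × EuclideanSpace ℝ (Fin 3)), W₁ ⊆ W → IsOpen W₁ → W₁.Nonempty →
          ∃ z ∈ W₁, ∃ b : Fin 3, b ≠ 2 ∧
            fderiv ℝ (v z.1) z.2 (EuclideanSpace.single 2 1) b ≠ m z.1 * fderiv ℝ (v z.1) z.2 (EuclideanSpace.single b 1) 2) →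
        ∃ s : ℝ, s < 0 ∧ ∃ U : Set (EuclideanSpace ℝ (Fin 3)), IsOpen U ∧ U.Nonempty ∧
          ((∃ e : EuclideanSpace ℝ (Fin 3), e ≠ 0 ∧ ∀ y ∈ U, fderiv ℝ (curl (v s)) y e = 0) ∨
           (∃ c : EuclideanSpace ℝ (Fin 3), ∀ y ∈ U,
              rotGen (curl (v s) y) = fderiv ℝ (curl (v s)) y (rotGen (y - c))))) :
    (∀ (C : ℝ) (v : ℝ → EuclideanSpace ℝ (Fin 3) → EuclideanSpace ℝ (Fin 3)),
      HasTypeITimeDecay C v →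
      ContinuousOn (Function.uncurry v) (Set.Iio (0 : ℝ) ×ˢ Set.univ) →
      (∀ s t : ℝ, s < t → t < 0 → ∀ x, v t x =
        UnboundedOperators.heatExtension (v s) (t - s) x - oseenDuhamel 1 s v v t x) →
      (∀ t < 0, VectorCalculus.IsDivFree (v t)) →
      (∀ s < 0, ∀ y, ⟪curl (v s) y, EuclideanSpace.single 2 1⟫_ℝ = 0) →
      ∀ W : Set (ℝ × EuclideanSpace ℝ (Fin 3)), IsOpen W → W.Nonempty → W ⊆ Set.Iio (0 : ℝ) ×ˢ Set.univ →
        (∀ z ∈ W, curl (v z.1) z.2 ≠ 0 ∧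
          (fderiv ℝ (v z.1) z.2 (EuclideanSpace.single 0 1) 2 ≠ 0 ∨ fderiv ℝ (v z.1) z.2 (EuclideanSpace.single 1 1) 2 ≠ 0) ∧
          (fderiv ℝ (v z.1) z.2 (EuclideanSpace.single 2 1) 0 ≠ 0 ∨ fderiv ℝ (v z.1) z.2 (EuclideanSpace.single 2 1) 1 ≠ 0)) →
        (∀ m : ℝ → ℝ, ∀ W₁ : Set (ℝ × EuclideanSpace ℝ (Fin 3)), W₁ ⊆ W → IsOpen W₁ → W₁.Nonempty →
          ∃ z ∈ W₁, ∃ b : Fin 3, b ≠ 2 ∧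
            fderiv ℝ (v z.1) z.2 (EuclideanSpace.single 2 1) b ≠ m z.1 * fderiv ℝ (v z.1) z.2 (EuclideanSpace.single b 1) 2) →
        ∃ s : ℝ, s < 0 ∧ ∃ U : Set (EuclideanSpace ℝ (Fin 3)), IsOpen U ∧ U.Nonempty ∧
          ((∃ e : EuclideanSpace ℝ (Fin 3), e ≠ 0 ∧ ∀ y ∈ U, fderiv ℝ (curl (v s)) y e = 0) ∨
           (∃ c : EuclideanSpace ℝ (Fin 3), ∀ y ∈ U,
              rotGen (curl (v s) y) = fderiv ℝ (curl (v s)) y (rotGen (y - c))) ∨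
           (∃ w : EuclideanSpace ℝ (Fin 3) → EuclideanSpace ℝ (Fin 3), AnalyticOnNhd ℝ w Set.univ ∧
              ¬ BddAbove (Set.range fun y => ‖w y‖) ∧ ∀ y ∈ U, v s y = w y))) := by
  intro C v hrate hcont hmild hdiv hpol W hW hWne hWs hnd hpin
  obtain ⟨s, hs, U, hU, hUne, halt⟩ := h C v hrate hcont hmild hdiv hpol W hW hWne hWs hnd hpin
  rcases halt with htr | hrot
  · exact ⟨s, hs, U, hU, hUne, Or.inl htr⟩
  · exact ⟨s, hs, U, hU, hUne, Or.inr (Or.inl hrot)⟩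

/-- **K2 from LRC″ with spatial pins (two-alternative form).**  The stratum (TV) is a tree theorem
(ns-poloidal-K2-p2 g3's `…TimeShearClosed.lrcSpatial_closes_tv`, built on K2-p3's `nonflatLiouville_of_lrc_spatial`,
K2-p2's `stub_tvLiminf` p525351 and the K2 lead's `…HorizontalFlatPast`), and the K2 lead's reduction
`…Sharper.poloidalWindowRigidity_of_sliceSharpNonflatLiouville` turns «class + poloidal ⇒ not backward-singular» into
the crux (its extra slice-sharp genericity hypotheses are not needed). -/
theorem poloidalWindowRigidity_of_lrcSpatial
    (h : ∀ (C : ℝ) (v : ℝ → EuclideanSpace ℝ (Fin 3) → EuclideanSpace ℝ (Fin 3)),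
      HasTypeITimeDecay C v →
      ContinuousOn (Function.uncurry v) (Set.Iio (0 : ℝ) ×ˢ Set.univ) →
      (∀ s t : ℝ, s < t → t < 0 → ∀ x, v t x =
        UnboundedOperators.heatExtension (v s) (t - s) x - oseenDuhamel 1 s v v t x) →
      (∀ t < 0, VectorCalculus.IsDivFree (v t)) →
      (∀ s < 0, ∀ y, ⟪curl (v s) y, EuclideanSpace.single 2 1⟫_ℝ = 0) →
      ∀ W : Set (ℝ × EuclideanSpace ℝ (Fin 3)), IsOpen W → W.Nonempty → W ⊆ Set.Iio (0 : ℝ) ×ˢ Set.univ →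
        (∀ z ∈ W, curl (v z.1) z.2 ≠ 0 ∧
          (fderiv ℝ (v z.1) z.2 (EuclideanSpace.single 0 1) 2 ≠ 0 ∨ fderiv ℝ (v z.1) z.2 (EuclideanSpace.single 1 1) 2 ≠ 0) ∧
          (fderiv ℝ (v z.1) z.2 (EuclideanSpace.single 2 1) 0 ≠ 0 ∨ fderiv ℝ (v z.1) z.2 (EuclideanSpace.single 2 1) 1 ≠ 0)) →
        (∀ m : ℝ → ℝ, ∀ W₁ : Set (ℝ × EuclideanSpace ℝ (Fin 3)), W₁ ⊆ W → IsOpen W₁ → W₁.Nonempty →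
          ∃ z ∈ W₁, ∃ b : Fin 3, b ≠ 2 ∧
            fderiv ℝ (v z.1) z.2 (EuclideanSpace.single 2 1) b ≠ m z.1 * fderiv ℝ (v z.1) z.2 (EuclideanSpace.single b 1) 2) →
        ∃ s : ℝ, s < 0 ∧ ∃ U : Set (EuclideanSpace ℝ (Fin 3)), IsOpen U ∧ U.Nonempty ∧
          ((∃ e : EuclideanSpace ℝ (Fin 3), e ≠ 0 ∧ ∀ y ∈ U, fderiv ℝ (curl (v s)) y e = 0) ∨
           (∃ c : EuclideanSpace ℝ (Fin 3), ∀ y ∈ U,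
              rotGen (curl (v s) y) = fderiv ℝ (curl (v s)) y (rotGen (y - c))))) :
    PoloidalWindowRigidity :=
  poloidalWindowRigidity_of_sliceSharpNonflatLiouville fun C v hrate hcont hmild hdiv hpol _ _ _ _ _ _ _ =>
    lrcSpatial_closes_tv C v hrate hcont hmild hdiv hpol (h C v hrate hcont hmild hdiv hpol)

/-- **THE SPLIT GLUE: `LrcModEntire → PoloidalWindowRigidity`** (crux K2, stmt-NavierStokesRegularity-19708, from the
promoted item stmt-NavierStokesRegularity-20428; both route declarations by name).  When the item lands as
`LrcModEntire_holds`, the crux is `poloidalWindowRigidity_of_lrcModEntire LrcModEntire_holds`. -/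
theorem poloidalWindowRigidity_of_lrcModEntire
    (h : (∀ (C : ℝ) (v : ℝ → EuclideanSpace ℝ (Fin 3) → EuclideanSpace ℝ (Fin 3)),
      HasTypeITimeDecay C v →
      ContinuousOn (Function.uncurry v) (Set.Iio (0 : ℝ) ×ˢ Set.univ) →
      (∀ s t : ℝ, s < t → t < 0 → ∀ x, v t x =
        UnboundedOperators.heatExtension (v s) (t - s) x - oseenDuhamel 1 s v v t x) →
      (∀ t < 0, VectorCalculus.IsDivFree (v t)) →
      (∀ s < 0, ∀ y, ⟪curl (v s) y, EuclideanSpace.single 2 1⟫_ℝ = 0) →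
      ∀ W : Set (ℝ × EuclideanSpace ℝ (Fin 3)), IsOpen W → W.Nonempty → W ⊆ Set.Iio (0 : ℝ) ×ˢ Set.univ →
        (∀ z ∈ W, curl (v z.1) z.2 ≠ 0 ∧
          (fderiv ℝ (v z.1) z.2 (EuclideanSpace.single 0 1) 2 ≠ 0 ∨ fderiv ℝ (v z.1) z.2 (EuclideanSpace.single 1 1) 2 ≠ 0) ∧
          (fderiv ℝ (v z.1) z.2 (EuclideanSpace.single 2 1) 0 ≠ 0 ∨ fderiv ℝ (v z.1) z.2 (EuclideanSpace.single 2 1) 1 ≠ 0)) →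
        (∀ m : ℝ → ℝ, ∀ W₁ : Set (ℝ × EuclideanSpace ℝ (Fin 3)), W₁ ⊆ W → IsOpen W₁ → W₁.Nonempty →
          ∃ z ∈ W₁, ∃ b : Fin 3, b ≠ 2 ∧
            fderiv ℝ (v z.1) z.2 (EuclideanSpace.single 2 1) b ≠ m z.1 * fderiv ℝ (v z.1) z.2 (EuclideanSpace.single b 1) 2) →
        ∃ s : ℝ, s < 0 ∧ ∃ U : Set (EuclideanSpace ℝ (Fin 3)), IsOpen U ∧ U.Nonempty ∧
          ((∃ e : EuclideanSpace ℝ (Fin 3), e ≠ 0 ∧ ∀ y ∈ U, fderiv ℝ (curl (v s)) y e = 0) ∨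
           (∃ c : EuclideanSpace ℝ (Fin 3), ∀ y ∈ U,
              rotGen (curl (v s) y) = fderiv ℝ (curl (v s)) y (rotGen (y - c))) ∨
           (∃ w : EuclideanSpace ℝ (Fin 3) → EuclideanSpace ℝ (Fin 3), AnalyticOnNhd ℝ w Set.univ ∧
              ¬ BddAbove (Set.range fun y => ‖w y‖) ∧ ∀ y ∈ U, v s y = w y)))) :
    PoloidalWindowRigidity :=
  poloidalWindowRigidity_of_lrcSpatial (lrcSpatial_of_lrcModEntire h)

/-! ### By-name forms (appended once the farm snapshot of the route file carried the item `LrcModEntire`, 2026-08-27) -/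

/-- **THE SPLIT GLUE BY NAME: `LrcModEntire → PoloidalWindowRigidity`** — both route declarations of
`Theses.PoloidalWindowDoor` by name (the item stmt-NavierStokesRegularity-20428 and the crux K2 stmt-NavierStokesRegularity-19708);
definitionally the same term as `poloidalWindowRigidity_of_lrcModEntire` (the route declaration unfolds to the spelled-out hypothesis).
Usage the day the item lands: `poloidalWindowRigidity_of_LrcModEntire LrcModEntire_holds`. -/
theorem poloidalWindowRigidity_of_LrcModEntire :
    Summit.NavierStokesRegularity.NavierStokesRegularity.Theses.PoloidalWindowDoor.LrcModEntire → PoloidalWindowRigidity :=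
  fun h => poloidalWindowRigidity_of_lrcModEntire h

/-- **`LrcModEntire` (by name) is EQUIVALENT to LRC″ with spatial pins in the two-alternative form** (v2's registered stub
`stub_lrcSpatial`): inside the route's Type-I class the third alternative (germ of an entire unbounded field) is void
(`lrcSpatial_of_lrcModEntire`, via nsreg-p7 g8's `…EntireGerm`), and conversely the two-alternative form embeds (`lrcModEntire_of_lrcSpatial`). -/
theorem lrcModEntire_iff_lrcSpatial :
    Summit.NavierStokesRegularity.NavierStokesRegularity.Theses.PoloidalWindowDoor.LrcModEntire ↔
    (∀ (C : ℝ) (v : ℝ → EuclideanSpace ℝ (Fin 3) → EuclideanSpace ℝ (Fin 3)),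
      HasTypeITimeDecay C v →
      ContinuousOn (Function.uncurry v) (Set.Iio (0 : ℝ) ×ˢ Set.univ) →
      (∀ s t : ℝ, s < t → t < 0 → ∀ x, v t x =
        UnboundedOperators.heatExtension (v s) (t - s) x - oseenDuhamel 1 s v v t x) →
      (∀ t < 0, VectorCalculus.IsDivFree (v t)) →
      (∀ s < 0, ∀ y, ⟪curl (v s) y, EuclideanSpace.single 2 1⟫_ℝ = 0) →
      ∀ W : Set (ℝ × EuclideanSpace ℝ (Fin 3)), IsOpen W → W.Nonempty → W ⊆ Set.Iio (0 : ℝ) ×ˢ Set.univ →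
        (∀ z ∈ W, curl (v z.1) z.2 ≠ 0 ∧
          (fderiv ℝ (v z.1) z.2 (EuclideanSpace.single 0 1) 2 ≠ 0 ∨ fderiv ℝ (v z.1) z.2 (EuclideanSpace.single 1 1) 2 ≠ 0) ∧
          (fderiv ℝ (v z.1) z.2 (EuclideanSpace.single 2 1) 0 ≠ 0 ∨ fderiv ℝ (v z.1) z.2 (EuclideanSpace.single 2 1) 1 ≠ 0)) →
        (∀ m : ℝ → ℝ, ∀ W₁ : Set (ℝ × EuclideanSpace ℝ (Fin 3)), W₁ ⊆ W → IsOpen W₁ → W₁.Nonempty →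
          ∃ z ∈ W₁, ∃ b : Fin 3, b ≠ 2 ∧
            fderiv ℝ (v z.1) z.2 (EuclideanSpace.single 2 1) b ≠ m z.1 * fderiv ℝ (v z.1) z.2 (EuclideanSpace.single b 1) 2) →
        ∃ s : ℝ, s < 0 ∧ ∃ U : Set (EuclideanSpace ℝ (Fin 3)), IsOpen U ∧ U.Nonempty ∧
          ((∃ e : EuclideanSpace ℝ (Fin 3), e ≠ 0 ∧ ∀ y ∈ U, fderiv ℝ (curl (v s)) y e = 0) ∨
           (∃ c : EuclideanSpace ℝ (Fin 3), ∀ y ∈ U,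
              rotGen (curl (v s) y) = fderiv ℝ (curl (v s)) y (rotGen (y - c))))) :=
  ⟨fun h => lrcSpatial_of_lrcModEntire h, fun h => lrcModEntire_of_lrcSpatial h⟩

end Summit.NavierStokesRegularity.NavierStokesRegularity.Theorems.PoloidalWindowDoorPoloidalWindowRigidityK2OfLrcModEntire

end
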